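import Literature.NumberTheory.Automorphic.OpenCellCoinvariants
import Literature.NumberTheory.Automorphic.ParabolicGLExactProofs
import Literature.NumberTheory.Automorphic.Zelevinsky1980.MaximalParabolicOpenCellRadical
import Literature.NumberTheory.Automorphic.Liu2021.LemD1SplitPlaceOfFacts
import HarnessLib

/-!
# `Ind_{P_c}^{GL_n} σ' ≠ 0` for a smooth `σ' ≠ 0`: the standard sections on the open cell are non-zero

Topic `NumberTheory/Automorphic` (generic smooth induction from a standard parabolic, next to
`OpenCellSections`); theorems only (no definition, no named fact).  Let `F` be a non-archimedean local field,
`c : Fin n → α` a monotone block labelling, `P_c ≤ GL_n(F)` its standard parabolic, `N'` the opposite-cell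
radical and `σ'` a SMOOTH representation of `P_c` on `W`.  The standard section `Φ_{K,w}` of `OpenCellSections`
(`cellSection`: `p w₀ n' ↦ 1_K(n') σ'(p) w`, for a compact open subgroup `K ≤ N'`) takes the value `w` at `w₀`
(`toFun_cellSection_w₀`), so it is non-zero for `w ≠ 0` (`cellSection_ne_zero`); compact open subgroups of `N'`
exist (the congruence boxes `N' ∩ K_γ`, `isOpen_comap_congruenceGL_oppositeCellRadical` /
`isCompact_comap_congruenceGL_oppositeCellRadical`, for ANY labelling `c` — the `Zelevinsky1980` versions are
stated for `lastBlockLabel`).  Hence: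

* `nontrivial_smoothInd_standardParabolicGL` — `Ind_{P_c}^{GL_n} σ'` (`Representation.SmoothInd`) is a
  non-zero space whenever `W ≠ 0`;
* `nontrivial_parabolicIndGL` — the same for the normalised induction `Representation.parabolicIndGL F c σ`
  of a smooth `σ ≠ 0` of the Levi (inducing datum `σ ∘ proj ⊗ δ^{1/2}`, smooth by
  `Representation.IsSmooth.twist_comp_leviProjection`);
* `Zelevinsky1980.nontrivial_parabolicIndGL_detChar` — the instance `(ν₀ ∘ det) × χ′` of the named fact
  `Zelevinsky1980.parabolicIndGL_detChar_unitary_isIrreducible` (continuous `ν₀, χ′`; the `[Nontrivial V]`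
  input of `Zelevinsky1980.isIrreducible_of_forall_intertwiningMap_of_exists_isCompl`, cell hodgecm-mathlib
  row IV-3b).

(Bernstein–Zelevinsky 1976, §2.22–2.24: `ind` is generated by functions supported on one chart; 1977,
Prop. 2.3 / Thm. 5.2: the open orbit contributes a non-zero subquotient.)

## References

* I. N. Bernstein, A. V. Zelevinsky, *Representations of the group GL(n, F) where F is a non-archimedean local
  field*, Russian Math. Surveys 31:3 (1976), §2.22–2.24. [BernsteinZelevinskyRMS1976]
* I. N. Bernstein, A. V. Zelevinsky, *Induced representations of reductive `p`-adic groups I*, Ann. Sci. ÉNS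
  10 (1977), Prop. 2.3, Thm. 5.2. [BernsteinZelevinskyASENS1977]
-/

noncomputable section

open Matrix ValuativeRel

namespace Literature.NumberTheory.Automorphic

section Boxes

variable {F : Type*} [Field F] [ValuativeRel F] [TopologicalSpace F] [IsNonarchimedeanLocalField F]
  {n : ℕ} {α : Type*} [LinearOrder α] (c : Fin n → α)

/-- The congruence box `N' ∩ K_γ` is open in `N'` (any block labelling). [cite: BernsteinZelevinskyRMS1976, §2.22] -/
theorem isOpen_comap_congruenceGL_oppositeCellRadical {γ : ValueGroupWithZero F} (hγ : γ ≠ 0) :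
    IsOpen (((congruenceGL n γ).comap (oppositeCellRadical (K := F) c).subtype :
      Subgroup ↥(oppositeCellRadical (K := F) c)) : Set ↥(oppositeCellRadical (K := F) c)) :=
  (isOpen_congruenceGL hγ).preimage continuous_subtype_val

/-- The congruence box `N' ∩ K_γ` is compact in `N'` (any block labelling; `N'` is closed). [cite: BernsteinZelevinskyRMS1976, §2.22] -/
theorem isCompact_comap_congruenceGL_oppositeCellRadical (γ : ValueGroupWithZero F) :
    IsCompact (((congruenceGL n γ).comap (oppositeCellRadical (K := F) c).subtype :
      Subgroup ↥(oppositeCellRadical (K := F) c)) : Set ↥(oppositeCellRadical (K := F) c)) :=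
  (isClosed_oppositeCellRadical (c := c)).isClosedEmbedding_subtypeVal.isCompact_preimage (isCompact_congruenceGL γ)

end Boxes

section Sections

variable {F : Type*} [Field F] [ValuativeRel F] [TopologicalSpace F] [IsNonarchimedeanLocalField F]
  {n : ℕ} {α : Type*} [LinearOrder α] [Fintype α] {c : Fin n → α}
  {W : Type*} [AddCommGroup W] [Module ℂ W]
  (σ' : Representation ℂ ↥(standardParabolicGL F c) W)

/-- **`Φ_{K,w}(w₀) = w`**: the standard section attached to a (compact open) subgroup `K ≤ N'` takes the value `w`
at `w₀ = 1 · w₀ · 1`. [cite: BernsteinZelevinskyRMS1976, §2.22] -/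
theorem toFun_cellSection_w₀ (hc : Monotone c) (hσ' : σ'.IsSmooth)
    (K : Subgroup ↥(oppositeCellRadical (K := F) c)) (hKo : IsOpen (K : Set ↥(oppositeCellRadical (K := F) c)))
    (hKc : IsCompact (K : Set ↥(oppositeCellRadical (K := F) c))) (w : W) :
    (cellSection σ' hc hσ' K hKo hKc w).toFun (permGL Fin.revPerm) = w := by
  have h := cellSectionFun_eq_of_mem (σ' := σ') hc (S := (K : Set ↥(oppositeCellRadical (K := F) c))) w
    (p := 1) (n' := 1) (Subgroup.one_mem _) (Subgroup.one_mem _) (by exact_mod_cast K.one_mem)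
  rw [one_mul, mul_one] at h
  rw [toFun_cellSection, h]
  have : (⟨(1 : GL (Fin n) F), Subgroup.one_mem _⟩ : ↥(standardParabolicGL F c)) = 1 := Subtype.ext rfl
  rw [this, map_one, Module.End.one_apply]

/-- **`Φ_{K,w} ≠ 0` for `w ≠ 0`.** [cite: BernsteinZelevinskyRMS1976, §2.22] -/
theorem cellSection_ne_zero (hc : Monotone c) (hσ' : σ'.IsSmooth)
    (K : Subgroup ↥(oppositeCellRadical (K := F) c)) (hKo : IsOpen (K : Set ↥(oppositeCellRadical (K := F) c)))
    (hKc : IsCompact (K : Set ↥(oppositeCellRadical (K := F) c))) {w : W} (hw : w ≠ 0) :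
    cellSection σ' hc hσ' K hKo hKc w ≠ 0 := by
  intro h0
  have h := toFun_cellSection_w₀ σ' hc hσ' K hKo hKc w
  rw [h0] at h
  exact hw (h.symm.trans (by
    have : (0 : Representation.SmoothInd (standardParabolicGL F c) σ').toFun = 0 := by
      rw [← zero_smul ℂ (cellSection σ' hc hσ' K hKo hKc w), Representation.SmoothInd.toFun_smul, zero_smul]
    rw [this, Pi.zero_apply]))

/-- **`Ind_{P_c}^{GL_n(F)} σ' ≠ 0`** for a smooth representation `σ'` of `P_c` on a non-zero space (`c` monotone):
the standard section `Φ_{K,w}`, `K = N' ∩ K_1`, `w ≠ 0`, is a non-zero element. [cite: BernsteinZelevinskyRMS1976, §2.22–2.24] -/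
theorem nontrivial_smoothInd_standardParabolicGL (hc : Monotone c) (hσ' : σ'.IsSmooth) [Nontrivial W] :
    Nontrivial (Representation.SmoothInd (standardParabolicGL F c) σ') := by
  obtain ⟨w, hw⟩ := exists_ne (0 : W)
  exact ⟨⟨_, 0, cellSection_ne_zero σ' hc hσ' _ (isOpen_comap_congruenceGL_oppositeCellRadical c one_ne_zero)
    (isCompact_comap_congruenceGL_oppositeCellRadical c 1) hw⟩⟩

end Sections

section Normalised

variable (F : Type*) [Field F] [ValuativeRel F] [TopologicalSpace F] [IsNonarchimedeanLocalField F]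
  {n : ℕ} {α : Type*} [LinearOrder α] [Fintype α] (c : Fin n → α)

/-- **`i_c σ ≠ 0`**: the normalised parabolic induction `Representation.parabolicIndGL F c σ` of a SMOOTH
representation `σ ≠ 0` of the Levi lives on a non-zero space (`c` monotone; the inducing datum
`σ ∘ proj ⊗ δ_{P_c}^{1/2}` is smooth by `Representation.IsSmooth.twist_comp_leviProjection`).
[cite: BernsteinZelevinskyASENS1977, Prop. 2.3] -/
theorem nontrivial_parabolicIndGL (hc : Monotone c) [LocallyCompactSpace (standardParabolicGL F c)]
    {W : Type*} [AddCommGroup W] [Module ℂ W] [Nontrivial W] (σ : Representation ℂ (Π a, GL {i // c i = a} F) W)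
    (hσ : σ.IsSmooth) :
    Nontrivial (Representation.SmoothInd (standardParabolicGL F c)
      (Representation.twist (σ.comp (leviProjection F c)) (rootDeltaChar (standardParabolicGL F c)))) :=
  nontrivial_smoothInd_standardParabolicGL _ hc (Representation.IsSmooth.twist_comp_leviProjection F c hσ)

end Normalised

end Literature.NumberTheory.Automorphic

namespace Literature.NumberTheory.Automorphic.Zelevinsky1980

open Literature.NumberTheory.Automorphic

/-- **`(ν₀ ∘ det) × χ′ ≠ 0`**: for a non-archimedean local field `F`, any `N`, and continuous characters
`ν₀, χ′ : Fˣ → ℂˣ`, the carrier of `parabolicIndGL F (lastBlockLabel N) (𝟙.twist (maxParabolicLeviChar F N ν₀ χ′))` is a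
non-zero space — the `[Nontrivial V]` input of `isIrreducible_of_forall_intertwiningMap_of_exists_isCompl` for the named
fact `parabolicIndGL_detChar_unitary_isIrreducible` (binders of the fact; unitarity unused).
[cite: BernsteinZelevinskyASENS1977, Prop. 2.3] -/
theorem nontrivial_parabolicIndGL_detChar (F : Type*) [Field F] [ValuativeRel F] [TopologicalSpace F]
    [IsNonarchimedeanLocalField F] (N : ℕ) [LocallyCompactSpace (standardParabolicGL F (lastBlockLabel N))]
    (ν₀ χ' : Fˣ →* ℂˣ) (hν₀c : Continuous fun x => ((ν₀ x : ℂˣ) : ℂ))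
    (hχ'c : Continuous fun x => ((χ' x : ℂˣ) : ℂ)) :
    Nontrivial (Representation.SmoothInd (standardParabolicGL F (lastBlockLabel N))
      (Representation.twist
        (((Representation.trivial ℂ (Π a : Bool, GL {i : Fin N // lastBlockLabel N i = a} F) ℂ).twist
          (maxParabolicLeviChar F N ν₀ χ')).comp (leviProjection F (lastBlockLabel N)))
        (rootDeltaChar (standardParabolicGL F (lastBlockLabel N))))) :=
  nontrivial_parabolicIndGL F (lastBlockLabel N) (monotone_lastBlockLabel N) _
    (Liu2021.SplitPlace.isAdmissible_trivial_twist _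
      (Liu2021.SplitPlace.isOpen_ker_maxParabolicLeviChar N ν₀ χ'
        (Liu2021.SplitPlace.isOpen_ker_of_continuous ν₀ hν₀c)
        (Liu2021.SplitPlace.isOpen_ker_of_continuous χ' hχ'c))).isSmooth

end Literature.NumberTheory.Automorphic.Zelevinsky1980

end
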